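import Mathlib
import HarnessLib
import Literature.Analysis.FluidPDE.LocalPressureOscillationSlab
import Summits.NavierStokesRegularity.NavierStokesRegularity.Theorems.PoloidalWindowDoorPoloidalWindowRigidityLargeScaleEnergyNearFieldTwo

/-!
# Route `PoloidalWindowDoor`, crux `PoloidalWindowRigidity` (K2, stmt-NavierStokesRegularity-19708) — whole-class tool:
# THE SLICE PRESSURE OSCILLATION ESTIMATE IN `L²` (exponent-`2` copy of the tree's
# `Literature.Analysis.FluidPDE.slice_pressure_oscillation_le`, which is stated at exponent `3/2`)

Cell ns-regularity-ideate, seat ns-poloidal-K2-p3 gen 3 (stub-worker under the K2 lead; file landed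
`--supports stmt-NavierStokesRegularity-19708` as a helper).  Second brick of the `L²` form of (F1) for the class
pressure (floor `α > 1` of the large-scale energy bootstrap).  Same proof as the tree's (Kang–Miura–Tsai §8 /
Lemma 3.4: mollify, split the renormalised potential into the Calderón–Zygmund near field of `1_S w ⊗ 1_S w` and the
far field `O(|y−x₀|⁻⁴)`, bound the constants, pass to the limit by Lebesgue points and Fatou), with the near field now
in `L²` (`exists_eLpNorm_nearField_le_two`) and squares in place of `3/2`-powers:
* `slice_pressure_oscillation_le_two` — `∃ CN CK: … ∃ κ, ∫⁻_{B(x₀,r)} ‖p − κ‖ₑ² ≤ 2·(CN² ∫⁻_{B(x₀,2(r+1))} ‖w‖ₑ⁴ +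
  |B(x₀,r)|·(CK(r+1) ∫⁻_{B(x₀,2(r+1))ᶜ} ‖w‖ₑ²|y−x₀|⁻⁴)²)`.
[cite: KangMiuraTsai2020, §8 proof of Lemma 3.4 (bounds for p_loc and p_far)]

WHAT THIS IS NOT: not a claim about Navier–Stokes regularity — potential theory of one slice (bears_on LADDER-NS N0 via
crux K2 = stmt-19708; whole-class tool).
-/

noncomputable section

-- the summit and its single sub-problem share the name (CONVENTIONS §1), as in every Theorems file
set_option linter.dupNamespace false

-- nested operator types `ℝ³ →L[ℝ] ℝ³ →L[ℝ] ℝ³ →L[ℝ] ℝ` (as in `LocalPressureLiouvilleKernel.lean`)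
set_option maxSynthPendingDepth 3

namespace Summit.NavierStokesRegularity.NavierStokesRegularity.Theorems.PoloidalWindowDoorPoloidalWindowRigidityLargeScaleEnergyPressureOscillationTwo

open MeasureTheory Set Filter Topology Function Metric
open scoped ENNReal NNReal RealInnerProductSpace Laplacian Convolution
open Literature.Analysis Literature.Analysis.FluidPDE
open Summit.NavierStokesRegularity.NavierStokesRegularity.Theorems.PoloidalWindowDoorPoloidalWindowRigidityLargeScaleEnergyNearFieldTwo

variable {α : Type*} [MeasurableSpace α] {F : Type*} [NormedAddCommGroup F]

/-! ### Exponent-`2` numerics -/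

/-- `∫ ‖f‖² = ‖f‖_{L²}²` (rpow form). [folklore] -/
theorem lintegral_rpow_two_eq' (f : α → F) (μ : Measure α) :
    ∫⁻ x, ‖f x‖ₑ ^ (2 : ℝ) ∂μ = eLpNorm f (2 : ℝ≥0∞) μ ^ (2 : ℝ) := by
  rw [eLpNorm_eq_lintegral_rpow_enorm_toReal two_ne_zero ENNReal.ofNat_ne_top, ENNReal.toReal_ofNat,
    ← ENNReal.rpow_mul]
  norm_num

/-- Finiteness transfer: `‖f‖_{L²} < ∞` when `∫ ‖f‖² < ∞`. [folklore] -/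
theorem eLpNorm_two_lt_top_of_lintegral {f : α → F} {μ : Measure α}
    (h : ∫⁻ x, ‖f x‖ₑ ^ (2 : ℝ) ∂μ ≠ ⊤) : eLpNorm f (2 : ℝ≥0∞) μ < ⊤ := by
  rw [eLpNorm_eq_lintegral_rpow_enorm_toReal two_ne_zero ENNReal.ofNat_ne_top, ENNReal.toReal_ofNat]
  exact ENNReal.rpow_lt_top_of_nonneg (by norm_num) h

/-- `‖ |a|² ‖ₑ² = ‖a‖ₑ⁴`. [folklore] -/
theorem enorm_norm_sq_rpow_two (a : F) :
    ‖(‖a‖ ^ 2 : ℝ)‖ₑ ^ (2 : ℝ) = ‖a‖ₑ ^ (4 : ℕ) := by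
  rw [Real.enorm_eq_ofReal (sq_nonneg _), ENNReal.ofReal_pow (norm_nonneg _),
    ofReal_norm, ← ENNReal.rpow_natCast _ 2, ← ENNReal.rpow_mul,
    ← ENNReal.rpow_natCast _ 4]
  norm_num

/-- `(a + b)² ≤ 2 (a² + b²)` in `ℝ≥0∞` (rpow form). [folklore] -/
theorem add_rpow_two_le (a b : ℝ≥0∞) :
    (a + b) ^ (2 : ℝ) ≤ (2 : ℝ≥0∞) * (a ^ (2 : ℝ) + b ^ (2 : ℝ)) := by
  have h := ENNReal.rpow_add_le_mul_rpow_add_rpow a b (by norm_num : (1 : ℝ) ≤ 2)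
  have e : ∀ x : ℝ≥0∞, x ^ (2 : ℝ) = x ^ (2 : ℕ) := fun x => by
    rw [← ENNReal.rpow_natCast]; norm_num
  rw [e, e, e]
  norm_num at h
  exact h

/-! ### The slice estimate -/

/-- **The pressure oscillation estimate on a slice, exponent `2`** (twin of the tree's
`slice_pressure_oscillation_le`; see the module docstring).
[cite: KangMiuraTsai2020, §8 proof of Lemma 3.4 (bounds for p_loc and p_far)] -/
theorem slice_pressure_oscillation_le_two :
    ∃ (CN : ℝ≥0) (CK : ℝ), 0 ≤ CK ∧
      ∀ (w : EuclideanSpace ℝ (Fin 3) → EuclideanSpace ℝ (Fin 3)) (A : ℝ≥0∞)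
        (p : EuclideanSpace ℝ (Fin 3) → ℝ), AEStronglyMeasurable w volume → A ≠ ⊤ →
        (∀ z : EuclideanSpace ℝ (Fin 3), ∫⁻ y in ball z 1, ‖w y‖ₑ ^ 2 ≤ A) →
        LocallyIntegrable p volume →
        (∀ (n : ℕ) (c e : EuclideanSpace ℝ (Fin 3)),
          ∫ x, (p x * fderiv ℝ (Δ (newtonReg ((n : ℝ) + 1)⁻¹)) (c - x) e +
            evalDiag (w x) (fderiv ℝ (fderiv ℝ (fderiv ℝ (newtonReg ((n : ℝ) + 1)⁻¹))) (c - x) e)) = 0) →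
        ∀ (x₀ : EuclideanSpace ℝ (Fin 3)) (r : ℝ), 0 < r →
          ∃ κ : ℝ, ∫⁻ c in ball x₀ r, ‖p c - κ‖ₑ ^ (2 : ℝ) ≤
            (2 : ℝ≥0∞) *
              ((CN : ℝ≥0∞) ^ (2 : ℝ) * (∫⁻ y in ball x₀ (2 * (r + 1)), ‖w y‖ₑ ^ (4 : ℕ)) +
                volume (ball x₀ r) * (ENNReal.ofReal (CK * (r + 1)) *
                  ∫⁻ y in (ball x₀ (2 * (r + 1)))ᶜ,
                    ‖w y‖ₑ ^ (2 : ℕ) * RieszKernel.powKer 4 (y - x₀)) ^ (2 : ℝ)) := by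
  obtain ⟨CN₀, hCN₀⟩ := exists_eLpNorm_nearField_le_two
  obtain ⟨CK, hCK0, hCK⟩ := exists_abs_pressureKernel_sub_le
  refine ⟨CN₀ + 1, CK, hCK0, fun w A p hw hAtop hA hp hid x₀ r hr => ?_⟩
  set CN : ℝ≥0 := CN₀ + 1 with hCNdef
  have hCN : ∀ δ : ℝ, 0 < δ → ∀ (x₀ : EuclideanSpace ℝ (Fin 3)) (R : ℝ)
      (w : EuclideanSpace ℝ (Fin 3) → EuclideanSpace ℝ (Fin 3)), AEStronglyMeasurable w volume →
      (∀ x, x ∉ ball x₀ R → w x = 0) → MemLp (fun x => ‖w x‖ ^ 2) 2 volume →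
        eLpNorm (fun c => ∫ y, evalDiag (w y) (fderiv ℝ (fderiv ℝ (newtonReg δ)) (c - y))) 2 volume ≤
          CN * eLpNorm (fun x => ‖w x‖ ^ 2) 2 volume := fun δ hδ x₀ R w hw hS hw2 =>
    (hCN₀ δ hδ x₀ R w hw hS hw2).trans (mul_le_mul' (by rw [hCNdef]; exact_mod_cast le_self_add) le_rfl)
  have hCNpos : (0 : ℝ≥0∞) < CN := by
    rw [hCNdef]; exact ENNReal.coe_pos.2 (add_pos_of_nonneg_of_pos bot_le one_pos)
  -- radii and sets
  set k : ℝ := r + 1 with hk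
  have hk0 : 0 < k := by linarith
  have hk2 : (2 : ℝ) ≤ 2 * k := by linarith
  set S : Set (EuclideanSpace ℝ (Fin 3)) := ball x₀ (2 * k) with hS
  set Br : Set (EuclideanSpace ℝ (Fin 3)) := ball x₀ r with hBr
  set μr : Measure (EuclideanSpace ℝ (Fin 3)) := volume.restrict Br with hμr
  set I4 : ℝ≥0∞ := ∫⁻ y in S, ‖w y‖ₑ ^ (4 : ℕ) with hI4
  set Tail : ℝ≥0∞ := ∫⁻ y in Sᶜ, ‖w y‖ₑ ^ (2 : ℕ) * RieszKernel.powKer 4 (y - x₀) with hTail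
  set RHS : ℝ≥0∞ := (2 : ℝ≥0∞) * ((CN : ℝ≥0∞) ^ (2 : ℝ) * I4 +
    volume Br * (ENNReal.ofReal (CK * k) * Tail) ^ (2 : ℝ)) with hRHS
  show ∃ κ : ℝ, ∫⁻ c in Br, ‖p c - κ‖ₑ ^ (2 : ℝ) ≤ RHS
  -- the trivial case `∫_S |w|⁴ = ∞`
  by_cases hI4top : I4 = ⊤
  · refine ⟨0, le_of_le_of_eq le_top ?_⟩
    rw [hRHS, hI4top, ENNReal.mul_top (ENNReal.rpow_pos hCNpos ENNReal.coe_ne_top).ne', top_add,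
      ENNReal.mul_top]
    exact two_ne_zero
  -- finiteness of the tail
  have hTail_le : Tail ≤ (volume (ball (0 : EuclideanSpace ℝ (Fin 3)) 1))⁻¹ *
      (A * (16 * ∫⁻ z in (ball (0 : EuclideanSpace ℝ (Fin 3)) (2 * k - 1))ᶜ, RieszKernel.powKer 4 z)) :=
    lintegral_compl_ball_mul_powKer_le (hw.enorm.pow_const _) hA x₀ hk2
  have hTailtop : Tail ≠ ⊤ := by
    refine ne_top_of_le_ne_top ?_ hTail_le
    refine ENNReal.mul_ne_top (ENNReal.inv_ne_top.2 (measure_ball_pos volume _ one_pos).ne')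
      (ENNReal.mul_ne_top hAtop (ENNReal.mul_ne_top (by norm_num) ?_))
    exact (RieszKernel.lintegral_compl_ball_powKer_lt_top (by norm_num) (by linarith)).ne
  -- the truncated field `W = 1_S w`
  set W : EuclideanSpace ℝ (Fin 3) → EuclideanSpace ℝ (Fin 3) := S.indicator w with hW
  have hWm : AEStronglyMeasurable W volume := hw.indicator measurableSet_ball
  have hWS : ∀ x, x ∉ S → W x = 0 := fun x hx => by rw [hW, indicator_of_notMem hx]
  have hW3 : ∫⁻ y, ‖(‖W y‖ ^ 2 : ℝ)‖ₑ ^ (2 : ℝ) = I4 := by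
    rw [hI4, ← lintegral_indicator measurableSet_ball]
    refine lintegral_congr fun y => ?_
    rw [enorm_norm_sq_rpow_two, hW]
    by_cases hy : y ∈ S
    · rw [indicator_of_mem hy, indicator_of_mem hy]
    · rw [indicator_of_notMem hy, indicator_of_notMem hy]
      simp
  have hW2 : MemLp (fun x => ‖W x‖ ^ 2) 2 volume := by
    refine ⟨(continuous_norm.pow 2).comp_aestronglyMeasurable hWm, ?_⟩
    exact eLpNorm_two_lt_top_of_lintegral (by rw [hW3]; exact hI4top)
  have hWi : Integrable (fun y => ‖W y‖ ^ 2) volume := by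
    have h32 : (1 : ℝ≥0∞) ≤ 2 := by norm_num
    haveI : IsFiniteMeasure ((volume : Measure (EuclideanSpace ℝ (Fin 3))).restrict (closedBall x₀ (2 * k))) :=
      ⟨by rw [Measure.restrict_apply_univ]; exact measure_closedBall_lt_top⟩
    have h1 : IntegrableOn (fun y => ‖W y‖ ^ 2) (closedBall x₀ (2 * k)) volume :=
      (hW2.restrict _).integrable h32
    exact h1.integrable_of_forall_notMem_eq_zero fun y hy => by
      simp [hWS y fun h => hy (ball_subset_closedBall h)]
  -- scales, mollified pressures, near fields
  set dn : ℕ → ℝ := fun n => ((n : ℝ) + 1)⁻¹ with hdn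
  have hdn0 : ∀ n, 0 < dn n := fun n => by positivity
  have hdn1 : ∀ n, dn n ≤ 1 := fun n => by
    rw [hdn]; exact inv_le_one_of_one_le₀ (by linarith [(n.cast_nonneg : (0 : ℝ) ≤ n)])
  set q : ℕ → EuclideanSpace ℝ (Fin 3) → ℝ := fun n =>
    Δ (newtonReg (dn n)) ⋆[ContinuousLinearMap.lsmul ℝ ℝ, volume] p with hq
  have hqc : ∀ n, Continuous (q n) := fun n =>
    (contDiff_laplacian_newtonReg_convolution (hdn0 n) hp).continuous
  set N : ℕ → EuclideanSpace ℝ (Fin 3) → ℝ := fun n c =>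
    ∫ y, evalDiag (W y) (fderiv ℝ (fderiv ℝ (newtonReg (dn n))) (c - y)) with hN
  set LPF : EuclideanSpace ℝ (Fin 3) → ℝ := fun c => localPressureFar x₀ k (fun _ => w) 0 c with hLPF
  -- (1) the key identity on `B_r(x₀)`
  set κ' : ℕ → ℝ := fun n => q n x₀ + N n x₀ with hκ'
  have hkey : ∀ n, ∀ c ∈ Br, q n c - κ' n = -N n c + LPF c := by
    intro n c hc
    have hcst := laplacian_newtonReg_convolution_add_potential_eq hw hAtop hA hp (hdn0 n)
      (fun c e => hid n c e) x₀ c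
    have hsplit := potential_eq_near_sub_far (A := A) hw hAtop hA (hdn0 n) (hdn1 n) x₀ hr
      (le_refl (r + 1)) hWi hc
    rw [hsplit] at hcst
    simp only [hκ', hq, hN, hLPF]
    linarith
  -- (2) bounds for the near field and the far field
  have hNbound : ∀ n, eLpNorm (N n) 2 volume ≤ CN * eLpNorm (fun x => ‖W x‖ ^ 2) 2 volume :=
    fun n => hCN (dn n) (hdn0 n) x₀ (2 * k) W hWm hWS hW2
  have hN32 : ∀ n, ∫⁻ c, ‖N n c‖ₑ ^ (2 : ℝ) ≤ (CN : ℝ≥0∞) ^ (2 : ℝ) * I4 := by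
    intro n
    rw [lintegral_rpow_two_eq', ← hW3, lintegral_rpow_two_eq',
      ← ENNReal.mul_rpow_of_nonneg _ _ (by norm_num)]
    exact ENNReal.rpow_le_rpow (hNbound n) (by norm_num)
  have hLPFb : ∀ c ∈ Br, ‖LPF c‖ₑ ≤ ENNReal.ofReal (CK * k) * Tail := fun c hc =>
    enorm_localPressureFar_le hCK0 hCK x₀ hk0 (fun _ => w) 0 (ball_subset_ball (by linarith) hc)
  -- (3) the constants `κ' n` are bounded
  obtain ⟨hl1c, hl1s, hl1i, -⟩ := laplacian_newtonReg_props (zero_lt_one' ℝ)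
  set Λ : ℝ≥0∞ := ∫⁻ s, ‖Δ (newtonReg 1) s‖ₑ with hΛ
  have hΛtop : Λ ≠ ⊤ := hl1i.2.ne
  have hΛn : ∀ n, ∫⁻ s, ‖Δ (newtonReg (dn n)) s‖ₑ = Λ := by
    intro n
    have h1 : ∀ {ε : ℝ}, 0 < ε → ∫⁻ s, ‖Δ (newtonReg ε) s‖ₑ = ENNReal.ofReal (∫ s, |Δ (newtonReg ε) s|) := by
      intro ε hε
      rw [ofReal_integral_eq_lintegral_ofReal (integrable_laplacian_newtonReg hε).abs
        (Eventually.of_forall fun s => abs_nonneg _)]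
      refine lintegral_congr fun s => ?_
      rw [Real.enorm_eq_ofReal_abs]
    rw [h1 (hdn0 n), hΛ, h1 one_pos, integral_abs_laplacian_newtonReg (hdn0 n),
      integral_abs_laplacian_newtonReg one_pos]
  set P1 : ℝ≥0∞ := ∫⁻ y in ball x₀ (r + 1), ‖p y‖ₑ with hP1
  have hP1top : P1 ≠ ⊤ := (hp.integrableOn_isCompact (isCompact_closedBall x₀ (r + 1))
    |>.mono_set ball_subset_closedBall).2.ne
  set Btot : ℝ≥0∞ := Λ * P1 + (volume Br + (CN : ℝ≥0∞) ^ (2 : ℝ) * I4 +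
    ENNReal.ofReal (CK * k) * Tail * volume Br) with hBtot
  have hBr_top : volume Br ≠ ⊤ := measure_ball_lt_top.ne
  have hBr_pos : volume Br ≠ 0 := (measure_ball_pos volume x₀ hr).ne'
  have hBtot_top : Btot ≠ ⊤ := by
    refine ENNReal.add_ne_top.2 ⟨ENNReal.mul_ne_top hΛtop hP1top, ENNReal.add_ne_top.2
      ⟨ENNReal.add_ne_top.2 ⟨hBr_top, ENNReal.mul_ne_top
        (ENNReal.rpow_ne_top_of_nonneg (by norm_num) ENNReal.coe_ne_top) hI4top⟩,
        ENNReal.mul_ne_top (ENNReal.mul_ne_top ENNReal.ofReal_ne_top hTailtop) hBr_top⟩⟩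
  have hone_add : ∀ x : ℝ≥0∞, x ≤ 1 + x ^ (2 : ℝ) := by
    intro x
    rcases le_or_gt x 1 with hx | hx
    · exact hx.trans le_self_add
    · calc x = x ^ (1 : ℝ) := (ENNReal.rpow_one x).symm
        _ ≤ x ^ (2 : ℝ) := ENNReal.rpow_le_rpow_of_exponent_le hx.le (by norm_num)
        _ ≤ 1 + x ^ (2 : ℝ) := le_add_self
  have hκ'bound : ∀ n, ‖κ' n‖ₑ * volume Br ≤ Btot := by
    intro n
    have hpt : ∀ c ∈ Br, ‖κ' n‖ₑ ≤ ‖q n c‖ₑ + ((1 + ‖N n c‖ₑ ^ (2 : ℝ)) + ENNReal.ofReal (CK * k) * Tail) := by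
      intro c hc
      have e1 : κ' n = q n c - (-N n c + LPF c) := by rw [← hkey n c hc]; ring
      calc ‖κ' n‖ₑ = ‖q n c - (-N n c + LPF c)‖ₑ := by rw [← e1]
        _ ≤ ‖q n c‖ₑ + ‖-N n c + LPF c‖ₑ := enorm_sub_le
        _ ≤ ‖q n c‖ₑ + (‖N n c‖ₑ + ‖LPF c‖ₑ) := by
            gcongr
            calc ‖-N n c + LPF c‖ₑ ≤ ‖-N n c‖ₑ + ‖LPF c‖ₑ := enorm_add_le _ _
              _ = ‖N n c‖ₑ + ‖LPF c‖ₑ := by rw [enorm_neg]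
        _ ≤ ‖q n c‖ₑ + ((1 + ‖N n c‖ₑ ^ (2 : ℝ)) + ENNReal.ofReal (CK * k) * Tail) :=
            add_le_add le_rfl (add_le_add (hone_add _) (hLPFb c hc))
    have hqm : AEMeasurable (fun c => ‖q n c‖ₑ) μr := (hqc n).measurable.enorm.aemeasurable
    calc ‖κ' n‖ₑ * volume Br = ∫⁻ _c in Br, ‖κ' n‖ₑ := by rw [setLIntegral_const]
      _ ≤ ∫⁻ c in Br, (‖q n c‖ₑ + ((1 + ‖N n c‖ₑ ^ (2 : ℝ)) + ENNReal.ofReal (CK * k) * Tail)) :=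
          setLIntegral_mono' measurableSet_ball hpt
      _ = (∫⁻ c in Br, ‖q n c‖ₑ) + ((volume Br + ∫⁻ c in Br, ‖N n c‖ₑ ^ (2 : ℝ)) +
            ENNReal.ofReal (CK * k) * Tail * volume Br) := by
          rw [lintegral_add_left' hqm, lintegral_add_right' _ aemeasurable_const,
            lintegral_add_left' aemeasurable_const, setLIntegral_const, setLIntegral_const, one_mul]
      _ ≤ Λ * P1 + ((volume Br + (CN : ℝ≥0∞) ^ (2 : ℝ) * I4) +
            ENNReal.ofReal (CK * k) * Tail * volume Br) := by
          gcongr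
          · calc ∫⁻ c in Br, ‖q n c‖ₑ ≤ (∫⁻ s, ‖Δ (newtonReg (dn n)) s‖ₑ) * P1 :=
                  lintegral_ball_laplacian_newtonReg_convolution_le (hdn0 n) (hdn1 n) hp x₀ r
              _ = Λ * P1 := by rw [hΛn n]
          · exact (lintegral_mono' Measure.restrict_le_self le_rfl).trans (hN32 n)
      _ = Btot := by rw [hBtot]
  set B : ℝ := (Btot / volume Br).toReal with hB
  have hκ'B : ∀ n, κ' n ∈ closedBall (0 : ℝ) B := by
    intro n
    rw [mem_closedBall_zero_iff, hB]
    have h1 : ‖κ' n‖ₑ ≤ Btot / volume Br := by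
      rw [ENNReal.le_div_iff_mul_le (Or.inl hBr_pos) (Or.inl hBr_top)]
      exact hκ'bound n
    have h2 : Btot / volume Br ≠ ⊤ := ENNReal.div_ne_top hBtot_top hBr_pos
    have h3 := ENNReal.toReal_mono h2 h1
    rwa [← ofReal_norm, ENNReal.toReal_ofReal (norm_nonneg _)] at h3
  -- (4) a convergent subsequence of the constants, and the a.e. convergence of the mollifications
  obtain ⟨κ, -, φ, hφ, hκlim⟩ := tendsto_subseq_of_bounded Metric.isBounded_closedBall hκ'B
  have hq_ae : ∀ᵐ c ∂μr, Tendsto (fun j => q (φ j) c) atTop (𝓝 (p c)) := by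
    have h := ae_tendsto_laplacian_newtonReg_convolution hp
    refine ae_restrict_of_ae (h.mono fun c hc => ?_)
    exact hc.comp hφ.tendsto_atTop
  refine ⟨κ, ?_⟩
  -- (5) Fatou
  set g : ℕ → EuclideanSpace ℝ (Fin 3) → ℝ≥0∞ := fun j c => ‖q (φ j) c - κ' (φ j)‖ₑ ^ (2 : ℝ) with hg
  have hgm : ∀ j, AEMeasurable (g j) μr := fun j =>
    (((hqc _).sub continuous_const).measurable.enorm.pow_const _).aemeasurable
  have hglim : ∀ᵐ c ∂μr, Tendsto (fun j => g j c) atTop (𝓝 (‖p c - κ‖ₑ ^ (2 : ℝ))) := by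
    filter_upwards [hq_ae] with c hc
    have h1 : Tendsto (fun j => q (φ j) c - κ' (φ j)) atTop (𝓝 (p c - κ)) := hc.sub hκlim
    exact ((ENNReal.continuous_rpow_const.tendsto _).comp ((continuous_enorm.tendsto _).comp h1))
  have hFatou : ∫⁻ c in Br, ‖p c - κ‖ₑ ^ (2 : ℝ) ≤ liminf (fun j => ∫⁻ c in Br, g j c) atTop := by
    calc ∫⁻ c in Br, ‖p c - κ‖ₑ ^ (2 : ℝ) = ∫⁻ c in Br, liminf (fun j => g j c) atTop :=
          lintegral_congr_ae (hglim.mono fun c hc => hc.liminf_eq.symm)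
      _ ≤ liminf (fun j => ∫⁻ c in Br, g j c) atTop := lintegral_liminf_le' hgm
  -- the bound for each `j`
  have hgbound : ∀ j, ∫⁻ c in Br, g j c ≤ RHS := by
    intro j
    have hpt : ∀ c ∈ Br, g j c ≤ (2 : ℝ≥0∞) *
        (‖N (φ j) c‖ₑ ^ (2 : ℝ) + (ENNReal.ofReal (CK * k) * Tail) ^ (2 : ℝ)) := by
      intro c hc
      rw [hg]
      dsimp only
      rw [hkey (φ j) c hc]
      calc ‖-N (φ j) c + LPF c‖ₑ ^ (2 : ℝ) ≤ (‖N (φ j) c‖ₑ + ENNReal.ofReal (CK * k) * Tail) ^ (2 : ℝ) := by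
            refine ENNReal.rpow_le_rpow ?_ (by norm_num)
            calc ‖-N (φ j) c + LPF c‖ₑ ≤ ‖-N (φ j) c‖ₑ + ‖LPF c‖ₑ := enorm_add_le _ _
              _ ≤ ‖N (φ j) c‖ₑ + ENNReal.ofReal (CK * k) * Tail := by
                  rw [enorm_neg]; exact add_le_add le_rfl (hLPFb c hc)
        _ ≤ _ := add_rpow_two_le _ _
    calc ∫⁻ c in Br, g j c ≤ ∫⁻ c in Br, (2 : ℝ≥0∞) *
          (‖N (φ j) c‖ₑ ^ (2 : ℝ) + (ENNReal.ofReal (CK * k) * Tail) ^ (2 : ℝ)) :=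
          setLIntegral_mono' measurableSet_ball hpt
      _ = (2 : ℝ≥0∞) * ((∫⁻ c in Br, ‖N (φ j) c‖ₑ ^ (2 : ℝ)) +
            (ENNReal.ofReal (CK * k) * Tail) ^ (2 : ℝ) * volume Br) := by
          rw [lintegral_const_mul' _ _ ENNReal.ofNat_ne_top,
            lintegral_add_right' _ aemeasurable_const, setLIntegral_const]
      _ ≤ RHS := by
          rw [hRHS, mul_comm ((ENNReal.ofReal (CK * k) * Tail) ^ (2 : ℝ)) (volume Br)]
          gcongr
          exact (lintegral_mono' Measure.restrict_le_self le_rfl).trans (hN32 _)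
  exact hFatou.trans (liminf_le_of_frequently_le' (Frequently.of_forall hgbound))

end Summit.NavierStokesRegularity.NavierStokesRegularity.Theorems.PoloidalWindowDoorPoloidalWindowRigidityLargeScaleEnergyPressureOscillationTwo

end
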